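/-
PORT (pub-hodgecm2, COR-CM cell) of the stage-1 package file `HodgeCMPerL/HodgeCM/StubTree/Qw8MilnePairs.lean`
(pub-hodgecm HOME/lean, bytes of record md5 40ca5404d578, 252 lines). Declarations VERBATIM; edits: imports rewritten to tree
modules, namespace token `HodgeCM` ↦ `Summit.HodgeConjecture.CorCM`, package `conjRingHomK` ↦ tree `Literature.NumberTheory.Automorphic.cmConjRingHom`
(definitionally equal bodies), linter fixes. Generator: pub-hodgecm2-p1 `work/port/build_kit.py`.
Filing delta A (pub-hodgecm2-b09, forced by gate `dedup.landed`): the package's auxiliary `Universe.injective_vecPair`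
(`a ≠ b → Function.Injective ![a, b]`) restates the landed `Literature.AlgebraicGeometry.Motives.ProjectiveSpaceCells.injective_vecCons_pair`
(Literature/AlgebraicGeometry/Motives/QuadricSurfaceLines.lean); the copy is deleted, that module imported, and its two use sites re-pointed.
Every other declaration byte-identical to the kit.
-/
import Summits.HodgeConjecture.CorCM.StubTree.Qw8Geometric
import Summits.HodgeConjecture.CorCM.Proofs.Pohlmann.PohlmannEq
import Summits.HodgeConjecture.CorCM.CM.AsymCoeff
import Summits.HodgeConjecture.CorCM.Proofs.PohlmannSpan
import Literature.AlgebraicGeometry.Motives.QuadricSurfaceLines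

/-!
# Complementary pairs and balanced cup monomials (the combinatorial half of `Qw8Milne`)

Split part 1/2 of `Summit.HodgeConjecture.CorCM.StubTree.Qw8Milne` (its §§1–2, unchanged): §1 complementary pairs — on a product
`A' = ∏ⱼ A_{Θⱼ}` of CM abelian varieties over ONE Galois CM field, the cup product of two degree-1 eigenclasses with
complementary CM types is a pulled-back Lefschetz (1,1) class, hence algebraic; §2 balanced cup monomials — a cup monomial of
degree-1 eigenclasses whose multiset of types is BALANCED (each type as often as its complement, `balanced_comp_equiv` for the
reindexing) is a product of complementary pairs, hence algebraic (model axioms via `ModelAxioms`, N1–N4, F4, F5).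
The positive-degree theorem `qw8MilnePos_of_facts`, the degree-0 residue `Qw8MilneZero` and the consequences for
`Qw8Sufficiency` / COR-CM are in `Summit.HodgeConjecture.CorCM.StubTree.Qw8Milne`, whose module docstring describes the whole.
-/

noncomputable section

open scoped TensorProduct NumberField Classical

namespace Summit.HodgeConjecture.CorCM

open Literature.AlgebraicGeometry.Motives (CMType HodgeStructure)
open Summit.HodgeConjecture.CorCM.Pohlmann
open Literature.AlgebraicGeometry.Motives.ProjectiveSpaceCells (injective_vecCons_pair)

namespace Universe

variable {U : Universe}

/-! ## 1. Complementary pairs -/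

section Pairs

variable {F : CMField} {n : ℕ} {Θ : Fin (n + 1) → CMType F}

/-- **A complementary pair is a Hodge weight of degree 2**: if `Ψ_{j',s'} = Ψ̄_{j,s}` then for every
`P ∈ GalT F` exactly one of `P s ∈ Θⱼ`, `P s' ∈ Θ_{j'}` holds (`mem_pullType`, `mem_barCM`). -/
theorem isHodgeWeight_wtOf_pair (a b : Fin (n + 1) × ((F : Type) →+* ℂ)) (hab : a ≠ b)
    (hτ : pullType (Θ b.1) b.2 = barCM (pullType (Θ a.1) a.2)) : IsHodgeWeight Θ 1 (wtOf 1 ![a, b]) := by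
  have hinj := injective_vecCons_pair hab
  refine ⟨?_, fun P => ?_⟩
  · have h := sum_eq_sum_wtOf ![a, b] hinj fun _ _ => (1 : ℤ)
    simp only [Finset.sum_const, Finset.card_univ, Fintype.card_fin, nsmul_eq_mul, mul_one] at h
    have h' : ((∑ j, (wtOf 1 ![a, b] j).card : ℕ) : ℤ) = 2 := by
      rw [Nat.cast_sum, ← h]; norm_num
    omega
  · rw [← sum_eq_sum_wtOf ![a, b] hinj fun j s => ind (Θ j) (P.1 s)]
    show ∑ i : Fin 2, ind (Θ (![a, b] i).1) (P.1 (![a, b] i).2) = ((1 : ℕ) : ℤ)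
    rw [Fin.sum_univ_two]
    simp only [Matrix.cons_val_zero, Matrix.cons_val_one, Nat.cast_one]
    have ha : P.1 a.2 ∈ (Θ a.1).1 ↔ P ∈ (pullType (Θ a.1) a.2).1 := (mem_pullType _ _ _).symm
    have hb : P.1 b.2 ∈ (Θ b.1).1 ↔ P ∉ (pullType (Θ a.1) a.2).1 := by rw [← mem_pullType, hτ, mem_barCM]
    have e1 : ind (Θ a.1) (P.1 a.2) = if P ∈ (pullType (Θ a.1) a.2).1 then 1 else 0 := by
      simp only [ind, ha]
    have e2 : ind (Θ b.1) (P.1 b.2) = if P ∈ (pullType (Θ a.1) a.2).1 then 0 else 1 := by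
      simp only [ind, hb, ite_not]
    rw [e1, e2]
    split_ifs <;> simp

variable (x : (j : Fin (n + 1)) → ((F : Type) →+* ℂ) → U.CohC (U.cmAV F (Θ j)) 1)

/-- the eigen-monomial on a pair of indices is the cup product of the two pulled-back eigen-classes -/
theorem fmono_pair (a b : Fin (n + 1) × ((F : Type) →+* ℂ)) :
    U.fmono x 1 ![a, b] = U.cupC (U.cmProd F Θ) 1 1 (U.fvec x a) (U.fvec x b) := rfl

/-- **Complementary pairs of eigen-classes cup to algebraic divisor classes**: `pr* x_{j,s} ∪ pr* x_{j',s'}`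
with `Ψ_{j',s'} = Ψ̄_{j,s}` is a weight vector of a Hodge weight of degree 2, hence (Pohlmann's theorem, direction
`⊇`: `baseChange_hodgeClassesOf_eq_iSup` of `Proofs/Pohlmann/PohlmannEq.lean`, seat pohl-g3) a complexified Hodge
class, hence (Lefschetz (1,1), M10) in `alg(A') 1 ⊗ ℂ`. -/
theorem cupC_fvec_mem_algC [IsGalois ℚ F] (M : U.ModelAxioms) (h29 : U.Fact_weightSpan)
    (h30 : U.Fact_weightHodge) (hx : ∀ j τ, x j τ ∈ U.eigenLine F (Θ j) τ)
    (a b : Fin (n + 1) × ((F : Type) →+* ℂ)) (hτ : pullType (Θ b.1) b.2 = barCM (pullType (Θ a.1) a.2)) :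
    U.cupC (U.cmProd F Θ) 1 1 (U.fvec x a) (U.fvec x b) ∈ U.algC (U.cmProd F Θ) 1 := by
  have hab : a ≠ b := by
    rintro rfl
    exact barCM_ne_self _ hτ.symm
  rw [← fmono_pair]
  have hW : U.fmono x 1 ![a, b] ∈ U.weightSpace F Θ (wtOf 1 ![a, b]) (1 + 1) :=
    (U.mem_weightSpace_iff F Θ _ _ _).2 (isWeightVector_fmono x M hx 1 ![a, b] (injective_vecCons_pair hab))
  have hB : U.fmono x 1 ![a, b] ∈ (U.hodgeClassesOf (U.cmProd F Θ) 1).baseChange ℂ := by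
    rw [baseChange_hodgeClassesOf_eq_iSup M h29 h30 1]
    exact Submodule.mem_iSup_of_mem _ (Submodule.mem_iSup_of_mem (isHodgeWeight_wtOf_pair a b hab hτ) hW)
  exact Submodule.baseChange_mono ℂ (M.lefschetz11 _) hB

end Pairs

/-! ## 2. Balanced cup monomials are algebraic -/

section Balanced

variable {X : U.Var}

/-- `cupPowC` as an alternating map (N1 `CupExterior`). -/
def cupPowA (X : U.Var) (k : ℕ) (hE : U.CupExterior X k) : U.CohC X 1 [⋀^Fin (k + 1)]→ₗ[ℂ] U.CohC X (k + 1) :=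
  { U.cupPowC X k with
    map_eq_zero_of_eq' := fun v _ _ hv hil => cupPowC_eq_zero_of_eq hE v hil hv }

/-- reordering an eigen-monomial costs a sign -/
theorem cupPowC_comp_perm (k : ℕ) (hE : U.CupExterior X k) (v : Fin (k + 1) → U.CohC X 1)
    (σ : Equiv.Perm (Fin (k + 1))) :
    U.cupPowC X k (v ∘ σ) = ((Equiv.Perm.sign σ : ℤ) : ℂ) • U.cupPowC X k v := by
  have h := (cupPowA X k hE).map_perm v σ
  rw [Units.smul_def, ← Int.cast_smul_eq_zsmul ℂ] at h
  exact h

variable {T : Type*} (bar : T → T)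

/-- in a `bar`-balanced family indexed by `Fin (N+1)` every index has a partner of conjugate type -/
theorem exists_partner (hfix : ∀ t, bar t ≠ t) {N : ℕ} (τ : Fin (N + 1) → T)
    (hbal : ∀ Ψ, (∑ i, if τ i = Ψ then (1 : ℤ) else 0) = ∑ i, if τ i = bar Ψ then (1 : ℤ) else 0)
    (i₀ : Fin (N + 1)) : ∃ l, l ≠ i₀ ∧ τ l = bar (τ i₀) := by
  by_contra hno
  push Not at hno
  have h0 : ∀ l, τ l ≠ bar (τ i₀) := fun l => by
    by_cases hl : l = i₀
    · rw [hl]; exact (hfix _).symm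
    · exact hno l hl
  have h1 := hbal (τ i₀)
  rw [Finset.sum_eq_zero (fun l _ => if_neg (h0 l))] at h1
  have h2 : (1 : ℤ) ≤ ∑ i, if τ i = τ i₀ then (1 : ℤ) else 0 :=
    calc (1 : ℤ) = if τ i₀ = τ i₀ then 1 else 0 := by simp
      _ ≤ ∑ i, if τ i = τ i₀ then (1 : ℤ) else 0 :=
        Finset.single_le_sum (f := fun i => if τ i = τ i₀ then (1 : ℤ) else 0)
          (fun i _ => by positivity) (Finset.mem_univ i₀)
  omega

/-- balance of a family of types (each value as often as its `bar`-partner) is invariant under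
reindexing by a permutation -/
theorem balanced_comp_equiv {N : ℕ} (τ : Fin N → T) (σ : Equiv.Perm (Fin N))
    (hbal : ∀ Ψ, (∑ i, if τ i = Ψ then (1 : ℤ) else 0) = ∑ i, if τ i = bar Ψ then (1 : ℤ) else 0) (Ψ : T) :
    (∑ i, if τ (σ i) = Ψ then (1 : ℤ) else 0) = ∑ i, if τ (σ i) = bar Ψ then (1 : ℤ) else 0 := by
  rw [Equiv.sum_comp σ (fun i => if τ i = Ψ then (1 : ℤ) else 0),
    Equiv.sum_comp σ (fun i => if τ i = bar Ψ then (1 : ℤ) else 0)]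
  exact hbal Ψ

/-- removing a complementary pair sitting in the last two slots keeps the family balanced -/
theorem balanced_init (hbar : Function.Involutive bar) {N : ℕ} (τ : Fin (N + 1 + 1) → T)
    (hlast : τ (Fin.last N).castSucc = bar (τ (Fin.last (N + 1))))
    (hbal : ∀ Ψ, (∑ i, if τ i = Ψ then (1 : ℤ) else 0) = ∑ i, if τ i = bar Ψ then (1 : ℤ) else 0) (Ψ : T) :
    (∑ i : Fin N, if τ i.castSucc.castSucc = Ψ then (1 : ℤ) else 0) =
      ∑ i : Fin N, if τ i.castSucc.castSucc = bar Ψ then (1 : ℤ) else 0 := by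
  have h := hbal Ψ
  simp only [Fin.sum_univ_castSucc, hlast] at h
  have e1 : (bar (τ (Fin.last (N + 1))) = Ψ) ↔ (τ (Fin.last (N + 1)) = bar Ψ) :=
    ⟨fun h' => by rw [← h', hbar], fun h' => by rw [h', hbar]⟩
  have e2 : (τ (Fin.last (N + 1)) = Ψ) ↔ (bar (τ (Fin.last (N + 1))) = bar Ψ) := hbar.injective.eq_iff.symm
  simp only [e1, e2] at h
  linarith

/-- **Balanced cup monomials are algebraic.**  If `v₀ ∪ … ∪ v_k` (`k + 1 = 2(m+1)` factors of degree 1) is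
indexed by types `τ i` forming a `bar`-balanced family, and every complementary pair `v i ∪ v l`
(`τ l = bar (τ i)`) is an algebraic divisor class, then the monomial is algebraic: reorder (N1, alternating),
re-bracket (F5), multiply (F4); induction on `m`. -/
theorem castC_cupPowC_mem_algC (h4 : U.Fact_cupAlg) (h5 : U.Fact_cupAssoc) (hE : ∀ k, U.CupExterior X k)
    (hbar : Function.Involutive bar) (hfix : ∀ t, bar t ≠ t) :
    ∀ (m k : ℕ) (hk : k + 1 = 2 * (m + 1)) (v : Fin (k + 1) → U.CohC X 1) (τ : Fin (k + 1) → T),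
      (∀ i l, τ l = bar (τ i) → U.cupC X 1 1 (v i) (v l) ∈ U.algC X 1) →
      (∀ Ψ, (∑ i, if τ i = Ψ then (1 : ℤ) else 0) = ∑ i, if τ i = bar Ψ then (1 : ℤ) else 0) →
      U.castC X hk (U.cupPowC X k v) ∈ U.algC X (m + 1) := by
  intro m
  induction m with
  | zero =>
    intro k hk v τ hpair hbal
    obtain rfl : k = 1 := by omega
    obtain ⟨l, hl1, hl⟩ := exists_partner bar hfix τ hbal (Fin.last 1)
    have h01 : τ (Fin.last 1) = bar (τ 0) := by
      have hl0 : l = 0 := by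
        rcases Fin.exists_fin_two.mp ⟨l, rfl⟩ with h | h
        · exact h
        · exact absurd h hl1
      rw [← hl0, hl, hbar]
    have hp := hpair 0 (Fin.last 1) h01
    have e : U.castC X hk (U.cupPowC X 1 v) = U.cupC X 1 1 (v 0) (v (Fin.last 1)) := rfl
    rw [e]
    exact hp
  | succ m ih =>
    intro k hk v τ hpair hbal
    obtain ⟨k₀, rfl⟩ : ∃ k₀, k = k₀ + 1 + 1 := ⟨k - 2, by omega⟩
    have hk₀ : k₀ + 1 = 2 * (m + 1) := by omega
    -- the partner `l` of the last slot `L`, moved to the second-to-last slot `J`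
    obtain ⟨l, hlL, hl⟩ := exists_partner bar hfix τ hbal (Fin.last (k₀ + 1 + 1))
    have hJL : (Fin.last (k₀ + 1)).castSucc ≠ Fin.last (k₀ + 1 + 1) := ne_of_lt (Fin.castSucc_lt_last _)
    set σ : Equiv.Perm (Fin (k₀ + 1 + 1 + 1)) := Equiv.swap l (Fin.last (k₀ + 1)).castSucc with hσ
    have hσL : σ (Fin.last (k₀ + 1 + 1)) = Fin.last (k₀ + 1 + 1) :=
      Equiv.swap_apply_of_ne_of_ne hlL.symm hJL.symm
    have hσJ : σ (Fin.last (k₀ + 1)).castSucc = l := Equiv.swap_apply_right _ _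
    set v' : Fin (k₀ + 1 + 1 + 1) → U.CohC X 1 := v ∘ σ with hv'
    set τ' : Fin (k₀ + 1 + 1 + 1) → T := τ ∘ σ with hτ'
    have hpair' : ∀ i l', τ' l' = bar (τ' i) → U.cupC X 1 1 (v' i) (v' l') ∈ U.algC X 1 :=
      fun _ _ h => hpair _ _ h
    have hbal' : ∀ Ψ, (∑ i, if τ' i = Ψ then (1 : ℤ) else 0) = ∑ i, if τ' i = bar Ψ then (1 : ℤ) else 0 :=
      balanced_comp_equiv bar τ σ hbal
    have hτ'J : τ' (Fin.last (k₀ + 1)).castSucc = bar (τ' (Fin.last (k₀ + 1 + 1))) := by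
      simp only [hτ', Function.comp_apply, hσJ, hσL]
      exact hl
    have hτ'L : τ' (Fin.last (k₀ + 1 + 1)) = bar (τ' (Fin.last (k₀ + 1)).castSucc) := by rw [hτ'J, hbar]
    -- the truncated monomial is balanced, hence algebraic (induction hypothesis)
    have hA : U.castC X hk₀ (U.cupPowC X k₀ fun i => v' i.castSucc.castSucc) ∈ U.algC X (m + 1) :=
      ih k₀ hk₀ (fun i => v' i.castSucc.castSucc) (fun i => τ' i.castSucc.castSucc)
        (fun i l' h => hpair' _ _ h) (balanced_init bar hbar τ' hτ'J hbal')
    -- the last pair is an algebraic divisor class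
    have hP : U.cupC X 1 1 (v' (Fin.last (k₀ + 1)).castSucc) (v' (Fin.last (k₀ + 1 + 1))) ∈ U.algC X 1 :=
      hpair' _ _ hτ'L
    -- re-bracket and multiply
    have hsucc : U.cupPowC X (k₀ + 1 + 1) v' = U.cupC X (k₀ + 1 + 1) 1
        (U.cupC X (k₀ + 1) 1 (U.cupPowC X k₀ fun i => v' i.castSucc.castSucc) (v' (Fin.last (k₀ + 1)).castSucc))
        (v' (Fin.last (k₀ + 1 + 1))) := rfl
    have hres := U.cupC_mem_algC h4 X (m + 1) 1 hA hP (by omega)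
    rw [cupC_castC_left, castC_castC] at hres
    have hv'mem : U.castC X hk (U.cupPowC X (k₀ + 1 + 1) v') ∈ U.algC X (m + 1 + 1) := by
      rw [hsucc, cupC_assoc U h5, castC_castC]
      exact hres
    -- back to `v = v' ∘ σ`
    have hvv' : v = v' ∘ σ := by
      funext i
      simp only [hv', Function.comp_apply, hσ, Equiv.swap_apply_self]
    rw [hvv', cupPowC_comp_perm _ (hE _) v' σ, map_smul]
    exact Submodule.smul_mem _ _ hv'mem

end Balanced

end Universe

end Summit.HodgeConjecture.CorCM

end
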